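import Literature.IUT.HodgeTheaters.PuncturedEllipticDihedralProfiniteModelCusps
import Literature.IUT.HodgeTheaters.PuncturedEllipticCoveringsCor12OfGeomOriginIotaEx48Final
import HarnessLib

/-!
# [IUTchI] §1 / Cor. 1.2: JOINT NON-VACUITY of the origin telescope of the Cor. 1.2 closer of record — ONE datum
# carrying `GeomOriginIota` AND `CuspGalois` with `l` prime, `[Π_X : Π_X̲] = l` and a geometric `ι̲` (proof-only)

Mochizuki, *Inter-universal Teichmüller theory I: construction of Hodge theaters*, kurims manuscript (May 2020),
§1 pp. 37–39 and Cor. 1.2 p. 39 [cite: Mochizuki2012, IUTchI Cor 1.2 p.39] (D-0012 claim key; series status DISPUTED —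
nothing of the series is asserted here).

PROOF-ONLY file (cell abc-iut, seat abc-iut-L5-t1 gen 12; L5 ROWS #7 R48 residual «NV-JOINT», L5-lead RULINGS #132
(2)(c); sequel of the four `PuncturedEllipticDihedralProfiniteModel*` files).  The [IUTchI] Cor. 1.2 closer of record
«cor12_v17» `InitialThetaData.pe_characteristicNatureOfCoverings_of_geomOriginIota_ex48` (abc-iut-w6-d032 p509616, over
this lineage's p508782 and abc-iut-L5-d4's p508526) displays, per datum, the ORIGIN record `GeomOriginIota` and the cusp
action `CuspGalois`, and its generic engines `GeomOriginIota.modLCuspLaws` / `GeomOriginIota.not_inertia_ε0_le_piXarrow_of_index`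
take in addition `l` prime, `[Π_X : Π_X̲] = l` and a geometric element of `Gal(X̲/C̲)`.  Until now these were inhabited
only SEPARATELY (abc-iut-L4-t15's profinite `D₀`: origin records, no cusp action possible; abc-iut-L5-d4's pro-`l`
`M_l`: cusp action, no free profinite `Δ_X`).  THIS FILE: at the dihedral profinite datum `D_l^∧ := datum l h5` (every
prime `l ≥ 5`) ALL FIVE hold simultaneously — `geomOriginIota l h5`, `cuspGalois l h5`, `datum_l_prime`,
`datum_relIndex` (`= l`, via this lineage's `CuspGalois.card_cusp`), `datum_exists_geomInvolution` (`η σ ∈ Δ_C̲ ∖ Δ_X̲`) —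
hence **the discharged law record `ModLCuspLaws` and the discharged GAP `h0` «`ε⁰` ramifies in `X̲→ → X̲`» HOLD at an
explicit datum** (`datum_modLCuspLaws_and_ramified`: the six `Δ_ε` sentences of [IUTchI] §1 and the
ramification of the zero cusp are TRUE statements about `(F₂ ⋊ ℤ/2)^∧` with its dihedral tower), and the packaged
existence statements `exists_nonempty_geomOriginIota_cuspGalois` (symbolic `l`) / `…_five` (`l = 5`).
CENSUS CONSEQUENCE: the hypotheses {`GeomOriginIota`, `CuspGalois`, `l` prime, `hX`, `hι`} of the Cor. 1.2 telescope are
JOINTLY CONSISTENT (kernel-checked model), so the LAW-0/GAP-0 discharge of p509616 is not vacuous at the §1 level.  The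
InitialThetaData-level closer itself is NOT instantiated here (no initial Θ-datum is built in the tree).

HONEST FRAMING: a group-theoretic model (profinite completion of the topological orbifold group of `C = X/{±1}` with
its dihedral covering tower `X̲ → X → C`, `C̲ → C`), not the étale `π₁` of a `k`-scheme; inhabited ≠ endorsed; nothing
here bears on [IUTchIII] Cor. 3.12 or asserts that abc is proved or refuted; no side taken.  No `def`, no instance, no
new `Prop` fact.
-/

noncomputable section

open CategoryTheory Topology ProfiniteGrp DihedralGroup

namespace Literature.IUT.HodgeTheaters

namespace PuncturedEllipticData

namespace DihedralProfiniteModel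

open Literature.AnabelianGeometry.AbsoluteAnabelian Literature.IUT.HodgeTheaters.ProfiniteCompletion

variable (l : ℕ) [Fact l.Prime]

/-! ### §1. The three side conditions of the Cor. 1.2 engines at the datum -/

/-- `l` is prime at the datum. [cite: Mochizuki2012, IUTchI §1 p.37] -/
theorem datum_l_prime (h5 : 5 ≤ l) : (datum l h5).l.Prime := Fact.out

/-- **`[Π_X : Π_X̲] = l` at the datum** (this lineage's `CuspGalois.card_cusp`: `#Cusp(X̲) = [Π_X : Π_X̲]`, and the cusps
are `ℤ/l`). [cite: Mochizuki2012, IUTchI §1 p.37] -/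
theorem datum_relIndex (h5 : 5 ≤ l) : (datum l h5).PiXbar.relIndex (datum l h5).PiX = (datum l h5).l := by
  haveI : NeZero l := neZero_l l
  rw [← (cuspGalois l h5).card_cusp]
  exact Nat.card_zmod l

/-- **A geometric element of `Gal(X̲/C̲)` at the datum**: `η σ ∈ Δ_C̲ ∖ Δ_X̲` (`ρ̂(η σ) = s r₀`).
[cite: Mochizuki2012, IUTchI §1 p.37] -/
theorem datum_exists_geomInvolution (h5 : 5 ≤ l) :
    ∃ c ∈ (datum l h5).DeltaCbar, c ∉ (datum l h5).DeltaXbar := by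
  refine ⟨toCompletion W (SemidirectProduct.inr gσ), ?_, ?_⟩
  · rw [datum_deltaCbar]
    exact Or.inr (by rw [ρhat_eta, ρW_inr, ρ2_gσ])
  · rw [datum_deltaXbar, MonoidHom.mem_ker, ρhat_eta, ρW_inr, ρ2_gσ]
    exact fun h => by cases h

/-- `G_k = 1` at the datum. [cite: Mochizuki2012, IUTchI §1 p.37] -/
theorem datum_subsingleton_gal (h5 : 5 ≤ l) : Subsingleton (datum l h5).E.gal :=
  inferInstance

/-! ### §2. The discharged laws HOLD at the datum -/

/-- **The six `Δ_ε`-level laws `ModLCuspLaws` of [IUTchI] §1 pp. 37–38 HOLD at the dihedral profinite datum, AND the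
zero cusp `ε⁰` RAMIFIES in `X̲→ → X̲` there** (`¬ I_{ε⁰} ⊆ Π_{X̲→}`: the GAP binder `h0` of G-L5d4g6-1 as a TRUE statement
about the model) — ONE CALL each of abc-iut-w6-d032's engines `GeomOriginIota.modLCuspLaws` /
`GeomOriginIota.not_inertia_ε0_le_piXarrow_of_index` (p509616; (L2a)(L2c) abc-iut-L5-d4 p508526, (L3)/(O2) abc-iut-L5-t1
p508782, (O1) p506921, (L0)(L1)(L4) by name) at `geomOriginIota l h5`, `cuspGalois l h5`.  (Stated as one conjunction:
the two conjuncts, taken alone, print like abc-iut-L5-d4's `M_l` statements `modLCuspLaws_datum` /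
`not_inertia_ε0_le_piXarrow_datum` about a DIFFERENT datum.) [cite: Mochizuki2012, IUTchI Cor 1.2 p.39] -/
theorem datum_modLCuspLaws_and_ramified (h5 : 5 ≤ l) :
    (datum l h5).ModLCuspLaws ∧ ¬ (datum l h5).inertia (datum l h5).ε0 ≤ (datum l h5).piXarrow :=
  ⟨(geomOriginIota l h5).modLCuspLaws (cuspGalois l h5) (datum_l_prime l h5) (datum_relIndex l h5),
    (geomOriginIota l h5).not_inertia_ε0_le_piXarrow_of_index (cuspGalois l h5) (datum_l_prime l h5)
      (datum_relIndex l h5) (datum_exists_geomInvolution l h5)⟩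

end DihedralProfiniteModel

open DihedralProfiniteModel Literature.IUT.HodgeTheaters.ProfiniteCompletion

/-! ### §3. The joint non-vacuity statements -/

/-- **JOINT NON-VACUITY of the origin telescope of the [IUTchI] Cor. 1.2 closer of record** (L5 RULINGS #132 (2)(c)):
for every prime `l ≥ 5` there is a `PuncturedEllipticData` with this `l` carrying SIMULTANEOUSLY a `GeomOriginIota`
record, a `CuspGalois` action, `l` prime, `[Π_X : Π_X̲] = l`, a geometric element of `Gal(X̲/C̲)`, and `G_k = 1` — the
dihedral profinite model `(F₂ ⋊ ℤ/2)^∧` with its tower `X̲ → X → C`, `C̲ → C`. [cite: Mochizuki2012, IUTchI Cor 1.2 p.39] -/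
theorem exists_nonempty_geomOriginIota_cuspGalois (l : ℕ) [Fact l.Prime] (h5 : 5 ≤ l) :
    ∃ D : PuncturedEllipticData.{0}, D.l = l ∧ Nonempty D.GeomOriginIota ∧ Nonempty D.CuspGalois ∧ D.l.Prime ∧
      D.PiXbar.relIndex D.PiX = D.l ∧ (∃ c ∈ D.DeltaCbar, c ∉ D.DeltaXbar) ∧ Subsingleton D.E.gal :=
  ⟨datum l h5, rfl, nonempty_geomOriginIota l h5, nonempty_cuspGalois l h5, datum_l_prime l h5, datum_relIndex l h5,
    datum_exists_geomInvolution l h5, datum_subsingleton_gal l h5⟩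

/-- The same at `l = 5` (no parameter). [cite: Mochizuki2012, IUTchI Cor 1.2 p.39] -/
theorem exists_nonempty_geomOriginIota_cuspGalois_five :
    ∃ D : PuncturedEllipticData.{0}, D.l = 5 ∧ Nonempty D.GeomOriginIota ∧ Nonempty D.CuspGalois ∧ D.l.Prime ∧
      D.PiXbar.relIndex D.PiX = D.l ∧ (∃ c ∈ D.DeltaCbar, c ∉ D.DeltaXbar) ∧ Subsingleton D.E.gal :=
  haveI : Fact (Nat.Prime 5) := ⟨Nat.prime_five⟩
  exists_nonempty_geomOriginIota_cuspGalois 5 le_rfl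

/-- **The discharged laws of the Cor. 1.2 closer are jointly satisfiable**: there is a datum carrying `GeomOriginIota` and
`CuspGalois` at which `ModLCuspLaws` holds and `ε⁰` ramifies in `X̲→ → X̲` (the conclusions of p509616's engines
`GeomOriginIota.modLCuspLaws` / `not_inertia_ε0_le_piXarrow_of_index` at an explicit datum).
[cite: Mochizuki2012, IUTchI Cor 1.2 p.39] -/
theorem exists_geomOriginIota_cuspGalois_modLCuspLaws_ramified :
    ∃ D : PuncturedEllipticData.{0}, Nonempty D.GeomOriginIota ∧ Nonempty D.CuspGalois ∧ D.ModLCuspLaws ∧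
      ¬ D.inertia D.ε0 ≤ D.piXarrow :=
  haveI : Fact (Nat.Prime 5) := ⟨Nat.prime_five⟩
  ⟨datum 5 le_rfl, nonempty_geomOriginIota 5 le_rfl, nonempty_cuspGalois 5 le_rfl, (datum_modLCuspLaws_and_ramified 5 le_rfl).1,
    (datum_modLCuspLaws_and_ramified 5 le_rfl).2⟩

end PuncturedEllipticData

end Literature.IUT.HodgeTheaters

end
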